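import Literature.Probability.RandomPlanarGeometry.SAWCountZdSymbolLowestCorner
import HarnessLib

/-!
# BLOCK STATISTICS FOR EVERY LAYER: two points in one block (`T(n−1,k+1) + T(n−2,k)`), an outer letter tied to a block axis, in associated-Stirling form

Topic `Literature/Probability/RandomPlanarGeometry` (the «SYMBOL POLYNOMIALITY» programme; all-layer infrastructure on `SAWCountZdSymbolTwoPartsRecurrence.lean` (a-p1 g27:
`assocStirling`, `card_twoParts_eq_assocStirling`), `SAWCountZdSymbolLowestCorner.lean` (a-p1 g27: `card_disjPairs_eq`, `card_abData_eq_sum`), `SAWCountZdSymbolSecondLowerCount.lean`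
(a-p1 g26: `twoParts`, `abData`, `outerPos`), the set-partition API of `HardCoreUrsell.lean` (`IsSetPartition`, `blockOf`)).

PRINTED CONTEXT (locators only). Charalambides (2018) Ch. 2 Exercise 32 (associated Stirling numbers of the second kind `T(n,k)`); Madras–Slade (1993) Definition 1.2.4.

THE THEOREM. The SECOND-lowest corner of every layer (five-run + split classes, FINDING-ZD-SYMBOL-POLYNOMIALITY §21 (v): proved for word lengths `2j` (6c) and `2j − 1` (car M),
conjectured in general and blind-registered as Am. BT-6/7) needs, beyond `#abData` (car H), two statistics of the (A, B, ρ) data for general `k`: HERE ★★ `card_twoParts_filter_mem_blockOf`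
— for `q ≠ q'` in `W`, **`#{ρ ∈ twoParts W (k+1) | q' ∈ blockOf ρ q} = T(#W−1, k+1) + T(#W−2, k)`** (merge `q'` into `q`: either the common block keeps size `≥ 2`, or it was the pair
`{q, q'}`); ★ `card_disjPairs_filter_mem` — the disjoint `(A, B) ⊆ O` with `o ∈ B` and `#A + #B = t + 1` number `2^t·C(#O−1, t)`; ★ `card_disjPairs_filter_pair` — with `{o, o'} ⊆ B`
and `#A + #B = t + 2`: `2^t·C(#O−2, t)`; ★ `disjPairs_filter_avoid` — avoiding `o, o'`: the disjoint pairs of `O ∖ {o, o'}`; hence ★★ `card_abData_filter_snd_eq_sum`: **`#{(A,B,ρ) ∈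
abData(m,j,p) | o ∈ B} = Σ_{t ≤ m−5} 2^t C(m−5,t) T(m−5−t, m−j−2)`** (an outer letter tied to the block axis `y`; symmetric for `A`), the `N_tied` of
§21 (v) — at `m = 2j − 1` it is car M's `(2j−7)‼` (`card_abData_filter_snd_values`).

THIS FILE (lane «pcv-sawmu», a-p1 g27; all PROVED, standard axioms): `sdiff_erase_erase_eq` (private), ★★ `card_twoParts_filter_mem_blockOf`, ★ `card_disjPairs_filter_mem`,
★ `card_disjPairs_filter_pair`, ★ `disjPairs_filter_avoid`, ★★ `card_abData_filter_snd_eq_sum`, `card_abData_filter_snd_values`, ★ `card_disjPairs_filter_pair_fst`, `sameBlockT`,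
★★ `card_twoParts_filter_mem_blockOf_eq`. NEXT (heir, recipe in FINDING §21 (v)): `#{(A,B,ρ) | o, o′ together} = Σ_t 2^t C(m−6,t)(2T(m−6−t,k) + S(m−4−t,k))` from these three.
[cite: Charalambides2018, Ch. 2 Exercise 32 (associated Stirling numbers of the second kind)] [cite: MadrasSlade1993, Definition 1.2.4]

Provenance: lane «pcv-sawmu», a-p1 g27 (2026-08-28).
-/

open Finset
open scoped BigOperators
open Literature.Probability.LatticeModels
open Literature.Probability.RandomPlanarGeometry.SAW
open Literature.Probability.Percolation
open Literature.MathematicalPhysics.QuantumFieldTheory.Balaban1983to89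
open Literature.MathematicalPhysics.QuantumFieldTheory.Balaban1983to89.HiggsFluctMeasureWickPairings

namespace Literature.Probability.RandomPlanarGeometry.SAW.Zd

namespace WordTypes

variable {m : ℕ}

/-! ### Two points in one block -/

/-- `(W.erase q') ∖ (B.erase q') = W ∖ B` when `q' ∈ B`. [cite: Charalambides2018, Ch. 2 Exercise 32; lane plumbing] -/
private theorem sdiff_erase_erase_eq {W B : Finset (Fin m)} {q' : Fin m} (hq'B : q' ∈ B) : W.erase q' \ B.erase q' = W \ B := by
  ext x
  simp only [Finset.mem_sdiff, Finset.mem_erase, not_and]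
  constructor
  · rintro ⟨⟨hxq, hxW⟩, h⟩
    exact ⟨hxW, fun hxB => h hxq hxB⟩
  · rintro ⟨hxW, hxB⟩
    exact ⟨⟨fun h => hxB (h ▸ hq'B), hxW⟩, fun _ => hxB⟩

open Classical in
/-- ★★ TWO POINTS IN ONE BLOCK: for `q ≠ q'` in `W`, `#{ρ ∈ twoParts W (k+1) | q' ∈ blockOf ρ q} = T(#W − 1, k+1) + T(#W − 2, k)` — remove `q'` from the common block (it keeps size
`≥ 2`: a partition of `W ∖ q'` into `k + 1` blocks, `q'` re-joins the block of `q`), or the block was the pair `{q, q'}` (a partition of `W ∖ {q, q'}` into `k` blocks).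
[cite: Charalambides2018, Ch. 2 Exercise 32 (associated Stirling numbers of the second kind); lane theorem] -/
theorem card_twoParts_filter_mem_blockOf {W : Finset (Fin m)} {q q' : Fin m} (hq : q ∈ W) (hq' : q' ∈ W) (hne : q ≠ q') (k : ℕ) :
    ((twoParts W (k + 1)).filter fun ρ => q' ∈ blockOf ρ q).card = assocStirling (W.card - 1) (k + 1) + assocStirling (W.card - 2) k := by
  set P := (twoParts W (k + 1)).filter fun ρ => q' ∈ blockOf ρ q with hP
  -- basic facts for members of `P`
  have hmem : ∀ ρ ∈ P, ρ ∈ twoParts W (k + 1) ∧ blockOf ρ q ∈ ρ ∧ q ∈ blockOf ρ q ∧ q' ∈ blockOf ρ q ∧ 2 ≤ (blockOf ρ q).card := by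
    intro ρ hρ
    rw [hP, Finset.mem_filter] at hρ
    have h := mem_twoParts.1 hρ.1
    have hB := h.1.blockOf_mem hq
    exact ⟨hρ.1, hB, h.1.mem_blockOf hq, hρ.2, h.2.1 _ hB⟩
  -- split by the size of the common block
  have hsplit : P.card = (P.filter fun ρ => 3 ≤ (blockOf ρ q).card).card + (P.filter fun ρ => (blockOf ρ q).card = 2).card := by
    rw [← Finset.card_union_of_disjoint (Finset.disjoint_filter.2 fun ρ _ h h' => by omega), ← Finset.filter_or,
      Finset.filter_true_of_mem fun ρ hρ => by have := (hmem ρ hρ).2.2.2.2; omega]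
  rw [hsplit]
  congr 1
  · -- the common block has size ≥ 3: remove `q'`
    rw [← card_twoParts_eq_assocStirling (W.card - 1) (W.erase q') (k + 1) (Finset.card_erase_of_mem hq')]
    have hqW' : q ∈ W.erase q' := Finset.mem_erase.2 ⟨hne, hq⟩
    -- forward membership
    have hfwd : ∀ ρ ∈ P.filter (fun ρ => 3 ≤ (blockOf ρ q).card),
        insert ((blockOf ρ q).erase q') (ρ.erase (blockOf ρ q)) ∈ twoParts (W.erase q') (k + 1) ∧ (blockOf ρ q).erase q' ∉ ρ.erase (blockOf ρ q) ∧
          blockOf (insert ((blockOf ρ q).erase q') (ρ.erase (blockOf ρ q))) q = (blockOf ρ q).erase q' := by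
      intro ρ hρ
      rw [Finset.mem_filter] at hρ
      obtain ⟨hρ, h3⟩ := hρ
      obtain ⟨hρT, hB, hqB, hq'B, -⟩ := hmem ρ hρ
      obtain ⟨hpart, h2, hk⟩ := mem_twoParts.1 hρT
      have h1 : IsSetPartition (W.erase q' \ (blockOf ρ q).erase q') (ρ.erase (blockOf ρ q)) := by rw [sdiff_erase_erase_eq hq'B]; exact hpart.erase hB
      have hne' : ((blockOf ρ q).erase q').Nonempty := ⟨q, Finset.mem_erase.2 ⟨hne, hqB⟩⟩
      have hsub : (blockOf ρ q).erase q' ⊆ W.erase q' := Finset.erase_subset_erase _ (hpart.subset hB)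
      have hnot := h1.notMem_of_sdiff hne'
      have hins := h1.insert hsub hne'
      refine ⟨mem_twoParts.2 ⟨hins, fun C hC => ?_, by rw [Finset.card_insert_of_notMem hnot, Finset.card_erase_of_mem hB, hk]; omega⟩, hnot,
        hins.eq_blockOf (Finset.mem_insert_self _ _) (Finset.mem_erase.2 ⟨hne, hqB⟩)⟩
      rcases Finset.mem_insert.1 hC with rfl | hC
      · rw [Finset.card_erase_of_mem hq'B]; omega
      · exact h2 C (Finset.mem_of_mem_erase hC)
    -- backward membership
    have hbwd : ∀ σ ∈ twoParts (W.erase q') (k + 1),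
        insert (insert q' (blockOf σ q)) (σ.erase (blockOf σ q)) ∈ P.filter (fun ρ => 3 ≤ (blockOf ρ q).card) ∧ insert q' (blockOf σ q) ∉ σ.erase (blockOf σ q) ∧
          q' ∉ blockOf σ q ∧ blockOf σ q ∈ σ ∧ blockOf (insert (insert q' (blockOf σ q)) (σ.erase (blockOf σ q))) q = insert q' (blockOf σ q) := by
      intro σ hσ
      obtain ⟨hpart, h2, hk⟩ := mem_twoParts.1 hσ
      have hC := hpart.blockOf_mem hqW'
      have hqC := hpart.mem_blockOf hqW'
      have hq'C : q' ∉ blockOf σ q := fun h => Finset.notMem_erase q' W (hpart.subset hC h)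
      have h1 : IsSetPartition (W \ insert q' (blockOf σ q)) (σ.erase (blockOf σ q)) := by
        rw [← sdiff_erase_erase_eq (Finset.mem_insert_self q' _), Finset.erase_insert hq'C]; exact hpart.erase hC
      have hne' : (insert q' (blockOf σ q)).Nonempty := Finset.insert_nonempty _ _
      have hsub : insert q' (blockOf σ q) ⊆ W := Finset.insert_subset hq' ((hpart.subset hC).trans (Finset.erase_subset _ _))
      have hnot := h1.notMem_of_sdiff hne'
      have hins := h1.insert hsub hne'
      have hblock : blockOf (insert (insert q' (blockOf σ q)) (σ.erase (blockOf σ q))) q = insert q' (blockOf σ q) :=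
        hins.eq_blockOf (Finset.mem_insert_self _ _) (Finset.mem_insert_of_mem hqC)
      have hmemT : insert (insert q' (blockOf σ q)) (σ.erase (blockOf σ q)) ∈ twoParts W (k + 1) := by
        refine mem_twoParts.2 ⟨hins, fun C hC' => ?_, by rw [Finset.card_insert_of_notMem hnot, Finset.card_erase_of_mem hC, hk]; omega⟩
        rcases Finset.mem_insert.1 hC' with rfl | hC'
        · rw [Finset.card_insert_of_notMem hq'C]; have := h2 _ hC; omega
        · exact h2 C (Finset.mem_of_mem_erase hC')
      refine ⟨?_, hnot, hq'C, hC, hblock⟩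
      rw [Finset.mem_filter, hP, Finset.mem_filter, hblock, Finset.card_insert_of_notMem hq'C]
      exact ⟨⟨hmemT, Finset.mem_insert_self _ _⟩, by have := h2 _ hC; omega⟩
    refine Finset.card_nbij' (fun ρ => insert ((blockOf ρ q).erase q') (ρ.erase (blockOf ρ q))) (fun σ => insert (insert q' (blockOf σ q)) (σ.erase (blockOf σ q)))
      (fun ρ hρ => (hfwd ρ hρ).1) (fun σ hσ => (hbwd σ hσ).1) (fun ρ hρ => ?_) (fun σ hσ => ?_)
    · rw [Finset.mem_coe] at hρ
      obtain ⟨-, hnot, hblock⟩ := hfwd ρ hρ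
      obtain ⟨-, hB, -, hq'B, -⟩ := hmem ρ (Finset.mem_filter.1 hρ).1
      simp only [hblock, Finset.insert_erase hq'B, Finset.erase_insert hnot, Finset.insert_erase hB]
    · rw [Finset.mem_coe] at hσ
      obtain ⟨-, hnot, hq'C, hC, hblock⟩ := hbwd σ hσ
      simp only [hblock, Finset.erase_insert hq'C, Finset.erase_insert hnot, Finset.insert_erase hC]
  · -- the common block is the pair `{q, q'}`: remove it
    have hpair : ∀ ρ ∈ P.filter (fun ρ => (blockOf ρ q).card = 2), blockOf ρ q = {q, q'} := by
      intro ρ hρ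
      rw [Finset.mem_filter] at hρ
      obtain ⟨-, -, hqB, hq'B, -⟩ := hmem ρ hρ.1
      exact (Finset.eq_of_subset_of_card_le (Finset.insert_subset hqB (Finset.singleton_subset_iff.2 hq'B)) (by rw [hρ.2, Finset.card_pair hne])).symm
    have hcardW : (W \ {q, q'}).card = W.card - 2 := by
      rw [Finset.card_sdiff_of_subset (Finset.insert_subset hq (Finset.singleton_subset_iff.2 hq')), Finset.card_pair hne]
    rw [← card_twoParts_eq_assocStirling (W.card - 2) (W \ {q, q'}) k hcardW]
    have hpairW : ({q, q'} : Finset (Fin m)) ⊆ W := Finset.insert_subset hq (Finset.singleton_subset_iff.2 hq')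
    refine Finset.card_nbij' (fun ρ => ρ.erase (blockOf ρ q)) (fun σ => insert {q, q'} σ) (fun ρ hρ => ?_) (fun σ hσ => ?_) (fun ρ hρ => ?_) (fun σ hσ => ?_)
    · rw [Finset.mem_coe] at hρ
      have hB := hpair ρ hρ
      obtain ⟨hρT, hBmem, -, -, -⟩ := hmem ρ (Finset.mem_filter.1 hρ).1
      obtain ⟨hpart, h2, hk⟩ := mem_twoParts.1 hρT
      rw [Finset.mem_coe, mem_twoParts, ← hB]
      exact ⟨hpart.erase hBmem, fun C hC => h2 C (Finset.mem_of_mem_erase hC), by rw [Finset.card_erase_of_mem hBmem, hk]; rfl⟩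
    · rw [Finset.mem_coe, mem_twoParts] at hσ
      obtain ⟨hpart, h2, hk⟩ := hσ
      have hnot : ({q, q'} : Finset (Fin m)) ∉ σ := hpart.notMem_of_sdiff (Finset.insert_nonempty _ _)
      have hins := hpart.insert hpairW (Finset.insert_nonempty _ _)
      have hblock : blockOf (insert {q, q'} σ) q = {q, q'} := hins.eq_blockOf (Finset.mem_insert_self _ _) (Finset.mem_insert_self _ _)
      rw [Finset.mem_coe, Finset.mem_filter, hP, Finset.mem_filter, hblock, Finset.card_pair hne]
      refine ⟨⟨mem_twoParts.2 ⟨hins, fun C hC => ?_, by rw [Finset.card_insert_of_notMem hnot, hk]⟩, by simp⟩, rfl⟩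
      rcases Finset.mem_insert.1 hC with rfl | hC
      · rw [Finset.card_pair hne]
      · exact h2 C hC
    · rw [Finset.mem_coe] at hρ
      have hB := hpair ρ hρ
      obtain ⟨-, hBmem, -⟩ := hmem ρ (Finset.mem_filter.1 hρ).1
      simp only [hB] at hBmem ⊢
      exact Finset.insert_erase hBmem
    · rw [Finset.mem_coe, mem_twoParts] at hσ
      obtain ⟨hpart, -, -⟩ := hσ
      have hnot : ({q, q'} : Finset (Fin m)) ∉ σ := hpart.notMem_of_sdiff (Finset.insert_nonempty _ _)
      have hins := hpart.insert hpairW (Finset.insert_nonempty _ _)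
      have hblock : blockOf (insert {q, q'} σ) q = {q, q'} := hins.eq_blockOf (Finset.mem_insert_self _ _) (Finset.mem_insert_self _ _)
      simp only [hblock, Finset.erase_insert hnot]

/-! ### Disjoint pairs through prescribed points -/

/-- ★ The disjoint `(A, B) ⊆ O` with `o ∈ B` and `#A + #B = t + 1` number `2^t·C(#O − 1, t)` (erase `o` from `B`). [cite: Charalambides2018, Ch. 2 Exercise 32; lane lemma] -/
theorem card_disjPairs_filter_mem {O : Finset (Fin m)} {o : Fin m} (ho : o ∈ O) (t : ℕ) :
    ((((O.powerset ×ˢ O.powerset).filter (fun AB : Finset (Fin m) × Finset (Fin m) => Disjoint AB.1 AB.2)).filter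
        (fun AB => AB.1.card + AB.2.card = t + 1)).filter (fun AB => o ∈ AB.2)).card = 2 ^ t * (O.card - 1).choose t := by
  classical
  rw [← Finset.card_erase_of_mem ho, ← card_disjPairs_eq (O.erase o) t]
  refine Finset.card_nbij' (fun AB => (AB.1, AB.2.erase o)) (fun AB => (AB.1, insert o AB.2)) (fun AB hAB => ?_) (fun AB hAB => ?_) (fun AB hAB => ?_) (fun AB hAB => ?_)
  · simp only [Finset.mem_coe, Finset.mem_filter, Finset.mem_product, Finset.mem_powerset] at hAB
    obtain ⟨⟨⟨⟨hA, hB⟩, hd⟩, he⟩, hoB⟩ := hAB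
    simp only [Finset.mem_coe, Finset.mem_filter, Finset.mem_product, Finset.mem_powerset]
    refine ⟨⟨⟨fun x hx => Finset.mem_erase.2 ⟨fun hxo => Finset.disjoint_left.1 hd hx (hxo ▸ hoB), hA hx⟩, Finset.erase_subset_erase _ hB⟩,
      Finset.disjoint_of_subset_right (Finset.erase_subset _ _) hd⟩, ?_⟩
    have := Finset.card_erase_of_mem hoB; have := Finset.card_pos.2 ⟨o, hoB⟩; omega
  · simp only [Finset.mem_coe, Finset.mem_filter, Finset.mem_product, Finset.mem_powerset] at hAB
    obtain ⟨⟨⟨hA, hB⟩, hd⟩, he⟩ := hAB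
    have hoA : o ∉ AB.1 := fun h => Finset.notMem_erase o O (hA h)
    have hoB : o ∉ AB.2 := fun h => Finset.notMem_erase o O (hB h)
    simp only [Finset.mem_coe, Finset.mem_filter, Finset.mem_product, Finset.mem_powerset]
    refine ⟨⟨⟨⟨fun x hx => Finset.mem_of_mem_erase (hA hx), Finset.insert_subset ho fun x hx => Finset.mem_of_mem_erase (hB hx)⟩,
      Finset.disjoint_insert_right.2 ⟨hoA, hd⟩⟩, ?_⟩, Finset.mem_insert_self _ _⟩
    have := Finset.card_insert_of_notMem hoB; omega
  · simp only [Finset.mem_coe, Finset.mem_filter] at hAB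
    obtain ⟨-, hoB⟩ := hAB
    simp only [Finset.insert_erase hoB]
  · simp only [Finset.mem_coe, Finset.mem_filter, Finset.mem_product, Finset.mem_powerset] at hAB
    obtain ⟨⟨⟨-, hB⟩, -⟩, -⟩ := hAB
    have hoB : o ∉ AB.2 := fun h => Finset.notMem_erase o O (hB h)
    simp only [Finset.erase_insert hoB]

/-- ★ The disjoint `(A, B) ⊆ O` with `{o, o'} ⊆ B` (`o ≠ o'`) and `#A + #B = t + 2` number `2^t·C(#O − 2, t)`. [cite: Charalambides2018, Ch. 2 Exercise 32; lane lemma] -/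
theorem card_disjPairs_filter_pair {O : Finset (Fin m)} {o o' : Fin m} (ho : o ∈ O) (ho' : o' ∈ O) (hne : o ≠ o') (t : ℕ) :
    ((((O.powerset ×ˢ O.powerset).filter (fun AB : Finset (Fin m) × Finset (Fin m) => Disjoint AB.1 AB.2)).filter
        (fun AB => AB.1.card + AB.2.card = t + 2)).filter (fun AB => o ∈ AB.2 ∧ o' ∈ AB.2)).card = 2 ^ t * (O.card - 2).choose t := by
  classical
  have ho'e : o' ∈ O.erase o := Finset.mem_erase.2 ⟨hne.symm, ho'⟩
  have hc : (O.erase o).card - 1 = O.card - 2 := by rw [Finset.card_erase_of_mem ho]; omega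
  rw [← hc, ← card_disjPairs_filter_mem ho'e t]
  -- erase `o` from `B`: lands in the pairs of `O.erase o` through `o'`
  refine Finset.card_nbij' (fun AB => (AB.1, AB.2.erase o)) (fun AB => (AB.1, insert o AB.2)) (fun AB hAB => ?_) (fun AB hAB => ?_) (fun AB hAB => ?_) (fun AB hAB => ?_)
  · simp only [Finset.mem_coe, Finset.mem_filter, Finset.mem_product, Finset.mem_powerset] at hAB
    obtain ⟨⟨⟨⟨hA, hB⟩, hd⟩, he⟩, hoB, ho'B⟩ := hAB
    simp only [Finset.mem_coe, Finset.mem_filter, Finset.mem_product, Finset.mem_powerset]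
    refine ⟨⟨⟨⟨fun x hx => Finset.mem_erase.2 ⟨fun hxo => Finset.disjoint_left.1 hd hx (hxo ▸ hoB), hA hx⟩, Finset.erase_subset_erase _ hB⟩,
      Finset.disjoint_of_subset_right (Finset.erase_subset _ _) hd⟩, ?_⟩, Finset.mem_erase.2 ⟨hne.symm, ho'B⟩⟩
    have := Finset.card_erase_of_mem hoB; have := Finset.card_pos.2 ⟨o, hoB⟩; omega
  · simp only [Finset.mem_coe, Finset.mem_filter, Finset.mem_product, Finset.mem_powerset] at hAB
    obtain ⟨⟨⟨⟨hA, hB⟩, hd⟩, he⟩, ho'B⟩ := hAB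
    have hoA : o ∉ AB.1 := fun h => Finset.notMem_erase o O (hA h)
    have hoB : o ∉ AB.2 := fun h => Finset.notMem_erase o O (hB h)
    simp only [Finset.mem_coe, Finset.mem_filter, Finset.mem_product, Finset.mem_powerset]
    refine ⟨⟨⟨⟨fun x hx => Finset.mem_of_mem_erase (hA hx), Finset.insert_subset ho fun x hx => Finset.mem_of_mem_erase (hB hx)⟩,
      Finset.disjoint_insert_right.2 ⟨hoA, hd⟩⟩, ?_⟩, Finset.mem_insert_self _ _, Finset.mem_insert_of_mem ho'B⟩
    have := Finset.card_insert_of_notMem hoB; omega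
  · simp only [Finset.mem_coe, Finset.mem_filter] at hAB
    obtain ⟨-, hoB, -⟩ := hAB
    simp only [Finset.insert_erase hoB]
  · simp only [Finset.mem_coe, Finset.mem_filter, Finset.mem_product, Finset.mem_powerset] at hAB
    obtain ⟨⟨⟨⟨-, hB⟩, -⟩, -⟩, -⟩ := hAB
    have hoB : o ∉ AB.2 := fun h => Finset.notMem_erase o O (hB h)
    simp only [Finset.erase_insert hoB]

/-- ★ The disjoint `(A, B) ⊆ O` avoiding `o` and `o'` are exactly the disjoint pairs of `O ∖ {o, o'}` (so, with `#A + #B = t`, they number `2^t·C(#O−2, t)` by `card_disjPairs_eq`).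
[cite: Charalambides2018, Ch. 2 Exercise 32; lane lemma] -/
theorem disjPairs_filter_avoid (O : Finset (Fin m)) (o o' : Fin m) :
    (((O.powerset ×ˢ O.powerset).filter (fun AB : Finset (Fin m) × Finset (Fin m) => Disjoint AB.1 AB.2)).filter
        (fun AB => o ∉ AB.1 ∪ AB.2 ∧ o' ∉ AB.1 ∪ AB.2)) =
      ((O \ {o, o'}).powerset ×ˢ (O \ {o, o'}).powerset).filter (fun AB : Finset (Fin m) × Finset (Fin m) => Disjoint AB.1 AB.2) := by
  classical
  ext AB
  simp only [Finset.mem_filter, Finset.mem_product, Finset.mem_powerset, Finset.mem_union, not_or, Finset.subset_sdiff, Finset.disjoint_insert_right,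
    Finset.disjoint_singleton_right]
  tauto

/-! ### An outer letter tied to a block axis, for every layer -/

open Classical in
/-- ★★ AN OUTER LETTER TIED TO A BLOCK AXIS, FOR EVERY `m`: `#{(A, B, ρ) ∈ abData(m, j, p) | o ∈ B} = Σ_{t ≤ m−5} 2^t·C(m−5, t)·T(m−5−t, m−j−2)` (`o`
an outer position; the same for `A`). [cite: MadrasSlade1993, Definition 1.2.4] [cite: Charalambides2018, Ch. 2 Exercise 32; lane theorem] -/
theorem card_abData_filter_snd_eq_sum {j p : ℕ} (hp : p + 4 ≤ m) {o : Fin m} (ho : o ∈ outerPos m p hp) :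
    ((abData m j p hp).filter fun d => o ∈ d.1.2).card = ∑ t ∈ Finset.range (m - 4), 2 ^ t * (m - 5).choose t * assocStirling (m - 5 - t) (m - j - 2) := by
  set O := outerPos m p hp with hO
  set D := (O.powerset ×ˢ O.powerset).filter (fun AB : Finset (Fin m) × Finset (Fin m) => Disjoint AB.1 AB.2) with hD
  have hOc : O.card = m - 4 := card_outerPos hp
  have hmemD : ∀ AB ∈ D, AB.1 ⊆ O ∧ AB.2 ⊆ O ∧ Disjoint AB.1 AB.2 := by
    intro AB hAB
    rw [hD, Finset.mem_filter, Finset.mem_product, Finset.mem_powerset, Finset.mem_powerset] at hAB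
    exact ⟨hAB.1.1, hAB.1.2, hAB.2⟩
  -- the filter of the sigma type is the sigma over the filtered base
  have hsig : ((abData m j p hp).filter fun d => o ∈ d.1.2) = (D.filter fun AB => o ∈ AB.2).sigma fun AB => twoParts (O \ (AB.1 ∪ AB.2)) (m - j - 2) := by
    unfold abData
    ext d
    constructor
    · intro h
      rw [Finset.mem_filter, Finset.mem_sigma] at h
      exact Finset.mem_sigma.2 ⟨Finset.mem_filter.2 ⟨h.1.1, h.2⟩, h.1.2⟩
    · intro h
      rw [Finset.mem_sigma, Finset.mem_filter] at h
      exact Finset.mem_filter.2 ⟨Finset.mem_sigma.2 ⟨h.1.1, h.2⟩, h.1.2⟩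
  rw [hsig, Finset.card_sigma]
  have hval : ∀ AB ∈ D.filter (fun AB => o ∈ AB.2),
      (twoParts (O \ (AB.1 ∪ AB.2)) (m - j - 2)).card = assocStirling (m - 5 - (AB.1.card + AB.2.card - 1)) (m - j - 2) := by
    intro AB hAB
    rw [Finset.mem_filter] at hAB
    obtain ⟨hA, hB, hd⟩ := hmemD AB hAB.1
    have hpos : 1 ≤ AB.2.card := Finset.card_pos.2 ⟨o, hAB.2⟩
    rw [card_twoParts_eq_assocStirling _ _ _ (by rw [Finset.card_sdiff_of_subset (Finset.union_subset hA hB), Finset.card_union_of_disjoint hd, hOc])]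
    congr 1; omega
  have hmaps : ∀ AB ∈ D.filter (fun AB => o ∈ AB.2), AB.1.card + AB.2.card - 1 ∈ Finset.range (m - 4) := by
    intro AB hAB
    rw [Finset.mem_filter] at hAB
    obtain ⟨hA, hB, hd⟩ := hmemD AB hAB.1
    have := Finset.card_le_card (Finset.union_subset hA hB)
    rw [Finset.card_union_of_disjoint hd, hOc] at this
    have hpos : 1 ≤ AB.2.card := Finset.card_pos.2 ⟨o, hAB.2⟩
    rw [Finset.mem_range]; omega
  rw [Finset.sum_congr rfl hval, ← Finset.sum_fiberwise_of_maps_to hmaps]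
  refine Finset.sum_congr rfl fun t ht => ?_
  rw [Finset.sum_congr rfl (g := fun _ => assocStirling (m - 5 - t) (m - j - 2)) (fun AB hAB => by rw [(Finset.mem_filter.1 hAB).2]), Finset.sum_const, smul_eq_mul]
  -- the fibre: `o ∈ B` and `#A + #B = t + 1`
  have hfib : ((D.filter fun AB => o ∈ AB.2).filter fun AB => AB.1.card + AB.2.card - 1 = t) =
      ((D.filter fun AB => AB.1.card + AB.2.card = t + 1).filter fun AB => o ∈ AB.2) := by
    ext AB
    simp only [Finset.mem_filter]
    constructor
    · rintro ⟨⟨hABD, hoB⟩, h⟩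
      have hpos : 1 ≤ AB.2.card := Finset.card_pos.2 ⟨o, hoB⟩
      exact ⟨⟨hABD, by omega⟩, hoB⟩
    · rintro ⟨⟨hABD, h⟩, hoB⟩; exact ⟨⟨hABD, hoB⟩, by omega⟩
  have hfc : ((((O.powerset ×ˢ O.powerset).filter (fun AB : Finset (Fin m) × Finset (Fin m) => Disjoint AB.1 AB.2)).filter
      (fun AB => AB.1.card + AB.2.card = t + 1)).filter (fun AB => o ∈ AB.2)).card = 2 ^ t * (m - 5).choose t := by
    rw [card_disjPairs_filter_mem ho t, hOc, show m - 4 - 1 = m - 5 by omega]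
  rw [hfib, hD, hfc]

/-- At `m = 2j − 1` (one ρ-block, `2j − 5` outer positions) the tied count is car M's `(2j−7)‼`: `j = 4, 5, 6, 7` give `1, 3, 15, 105`.
[cite: MadrasSlade1993, Definition 1.2.4; lane theorem] -/
theorem card_abData_filter_snd_values :
    (∑ t ∈ Finset.range (2 * 4 - 1 - 4), 2 ^ t * (2 * 4 - 1 - 5).choose t * assocStirling (2 * 4 - 1 - 5 - t) (2 * 4 - 1 - 4 - 2) = 1) ∧
    (∑ t ∈ Finset.range (2 * 5 - 1 - 4), 2 ^ t * (2 * 5 - 1 - 5).choose t * assocStirling (2 * 5 - 1 - 5 - t) (2 * 5 - 1 - 5 - 2) = 3) ∧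
    (∑ t ∈ Finset.range (2 * 6 - 1 - 4), 2 ^ t * (2 * 6 - 1 - 5).choose t * assocStirling (2 * 6 - 1 - 5 - t) (2 * 6 - 1 - 6 - 2) = 15) ∧
    (∑ t ∈ Finset.range (2 * 7 - 1 - 4), 2 ^ t * (2 * 7 - 1 - 5).choose t * assocStirling (2 * 7 - 1 - 5 - t) (2 * 7 - 1 - 7 - 2) = 105) := by
  refine ⟨by decide, by decide, by decide, by decide⟩

/-- ★ The same with `{o, o'} ⊆ A`: `2^t·C(#O − 2, t)` (swap the coordinates). [cite: Charalambides2018, Ch. 2 Exercise 32; lane lemma] -/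
theorem card_disjPairs_filter_pair_fst {O : Finset (Fin m)} {o o' : Fin m} (ho : o ∈ O) (ho' : o' ∈ O) (hne : o ≠ o') (t : ℕ) :
    ((((O.powerset ×ˢ O.powerset).filter (fun AB : Finset (Fin m) × Finset (Fin m) => Disjoint AB.1 AB.2)).filter
        (fun AB => AB.1.card + AB.2.card = t + 2)).filter (fun AB => o ∈ AB.1 ∧ o' ∈ AB.1)).card = 2 ^ t * (O.card - 2).choose t := by
  classical
  rw [← card_disjPairs_filter_pair ho ho' hne t]
  refine Finset.card_nbij' (fun AB => (AB.2, AB.1)) (fun AB => (AB.2, AB.1)) (fun AB hAB => ?_) (fun AB hAB => ?_) (fun AB _ => rfl) (fun AB _ => rfl)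
  · simp only [Finset.mem_coe, Finset.mem_filter, Finset.mem_product, Finset.mem_powerset] at hAB ⊢
    obtain ⟨⟨⟨⟨hA, hB⟩, hd⟩, he⟩, h⟩ := hAB
    exact ⟨⟨⟨⟨hB, hA⟩, hd.symm⟩, by omega⟩, h⟩
  · simp only [Finset.mem_coe, Finset.mem_filter, Finset.mem_product, Finset.mem_powerset] at hAB ⊢
    obtain ⟨⟨⟨⟨hA, hB⟩, hd⟩, he⟩, h⟩ := hAB
    exact ⟨⟨⟨⟨hB, hA⟩, hd.symm⟩, by omega⟩, h⟩

/-- The two-points-in-one-block count `S(N, k)`: `0` for `k = 0`, `T(N−1, k) + T(N−2, k−1)` for `k ≥ 1`. [cite: Charalambides2018, Ch. 2 Exercise 32; lane tool notion] -/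
def sameBlockT (N : ℕ) : ℕ → ℕ
  | 0 => 0
  | k + 1 => assocStirling (N - 1) (k + 1) + assocStirling (N - 2) k

open Classical in
/-- ★★ `#{ρ ∈ twoParts W k | q' ∈ blockOf ρ q} = S(#W, k)` for every `k` (`k = 0`: no partition of a non-empty set into no blocks). [cite:
Charalambides2018, Ch. 2 Exercise 32; lane theorem] -/
theorem card_twoParts_filter_mem_blockOf_eq {W : Finset (Fin m)} {q q' : Fin m} (hq : q ∈ W) (hq' : q' ∈ W) (hne : q ≠ q') (k : ℕ) :
    ((twoParts W k).filter fun ρ => q' ∈ blockOf ρ q).card = sameBlockT W.card k := by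
  rcases k with _ | k
  · rw [sameBlockT, Finset.card_eq_zero, Finset.filter_eq_empty_iff]
    intro ρ hρ _
    have h := card_twoParts_zero_right W
    rw [if_neg (Finset.nonempty_iff_ne_empty.1 ⟨q, hq⟩), Finset.card_eq_zero] at h
    rw [h] at hρ
    simp at hρ
  · rw [sameBlockT, card_twoParts_filter_mem_blockOf hq hq' hne k]

end WordTypes

end Literature.Probability.RandomPlanarGeometry.SAW.Zd
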